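/-
Copyright (c) 2026. All rights reserved.
Released under Apache 2.0 license as described in the file LICENSE.
Authors: abc-iut cell, Cor. 3.12 sub-crew seat abc-iut-c312-3 (gen 10), over abc-iut-s2-p12's
`UnitLogInnerRadiusTieTorsion*` and abc-iut-w5-d039's `TorsionUnits` / `UnitLogBallTorsionCensus`.
-/
import Literature.IUT.LogVolume.UnitLogInnerRadiusTieTorsionGenerator
import HarnessLib

/-!
# The inner radius at a TIE index `e = A·(p−1)`, IIIe: the torsion-witness criterion over `m = torsionPExp p K`
# — `p^m ∤ A ⇒ r_in = A + 1`, and ONE congruence on a generator of `μ_{p^∞}(K)` otherwise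

Proof-only sequel (theorems, no definitions, no named fact) of `UnitLogInnerRadiusTieTorsionGenerator.lean` (§1–§4:
generator normal form of abc-iut-s2-p12's torsion witness; a witness forces `p^{k+1} ∣ A` whenever `ζ_{p^{k+1}} ∈ K`).
Setting as there: `K` a proper ultrametric normed `ℚ_p`-algebra field, `p` ODD, `ϖ` a norm uniformizer,
`e = absRamificationIdx p K = A·(p−1)` (ANY `A`), `Λ := log_p(𝒪_K^×) = logUnits K`; `m := torsionPExp p K` is
abc-iut-w5-d039's exponent of the `p`-primary torsion of `𝒪_K^×` (`#R^μ = p^m·(p^f − 1)`, `TorsionUnits.lean`), and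
`exists_isPrimitiveRoot_pow_torsionPExp` supplies a primitive `p^m`-th root of unity.

* §5 `le_torsionPExp_of_isPrimitiveRoot`: a primitive `p^n`-th root of unity in `K` forces `n ≤ m` (its order divides
  `#R^μ`); `not_pow_prime_eq_of_isPrimitiveRoot_torsionPExp`: a primitive `p^m`-th root of unity (`m ≥ 1`) is never a
  `p`-th power in `K` — so it is a generator in the sense of §3;
  **`closedBall_level_subset_logUnits_iff_torsionPExp`** (`m ≥ 1`, `ξ` primitive of order `p^m`):
  `{‖z‖ ≤ ‖ϖ‖^A} ⊆ log_p(𝒪_K^×) ⟺ ∃ u, ‖u^p − ξ‖ ≤ ‖p‖·‖ϖ‖^A`;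
  **`innerRadius_tie_succ_of_not_pow_torsionPExp_dvd`**: `m ≥ 1 ∧ p^m ∤ A ⇒ r_in = A + 1` (R-W format
  `closedBall 0 ‖ϖ‖^{A+1} ⊆ logUnits K ∧ ¬ closedBall 0 ‖ϖ‖^A ⊆ logUnits K`), e.g. `ζ_9 ∈ K_w` over `p = 3` with
  `9 ∤ e_w/2`; **`pow_torsionPExp_dvd_level_of_torsionWitness`**: a torsion witness forces `p^m ∣ A`
  (abc-iut-s2-p12's open item (γ) in sharp form).

* §6 (v2) **a NEGATIVE CERTIFICATE** (`not_exists_torsionWitness_of_eq_pow_mul`, `innerRadius_tie_succ_of_eq_pow_mul`):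
  `ξ = u^p·v` with `‖1 − v‖ = ‖ϖ‖^s`, `1 ≤ s < A·p`, `p ∤ s` (what a stuck greedy `p`-th-root lift of `ζ_{p^m}` returns)
  ⇒ no torsion witness ⇒ `r_in = A + 1`; so BOTH outcomes of the one congruence carry a finite kernel-checkable
  certificate.

TABLE RECIPE (R-W lane U, col «rho_in», `p` odd, `e_w = A(p−1)`, `ζ_p ∈ K_w`, `p^m = #μ_{p^∞}(K_w)`): if `p^m ∤ A`
then `r_in = A + 1`; else `r_in = A + 1 − [∃ u, ‖u^p − ζ_{p^m}‖ ≤ ‖p‖·‖ϖ‖^A]` — one congruence modulo `𝔪^{pA}`.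

References: [cite: SerreLocalFields1979, Ch. XIV §4] [cite: NeukirchANT1999, Ch. II Prop. (5.5)–(5.7), (7.13)]
[cite: Washington1997, Lemma 1.4, §5.1].  Classical `p`-adic analysis; `logUnits` is the cell's typing of
[IUTchIV] Prop. 1.2's `log_p(R^×)` ([claim: Mochizuki2012, status: disputed] for that locution only).  Consumer
(record only): D-0079 R-W lane U column «rho_in» at tie places with `p ∣ A` and `ζ_p ∈ K_w`.  Nothing here is
disputed mathematics; no IUT statement is asserted; nothing bears on [IUTchIII] Cor. 3.12.
-/

noncomputable section

open Metric Set IsUltrametricDist IsLocalRing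
open scoped NormedField

namespace Literature.IUT.LogVolume

open Literature.NumberTheory.GaloisRepresentations.Ultrametric BoundaryRamification

namespace LogEnvelope

section Field

variable (p : ℕ) [hp : Fact p.Prime]
variable {K : Type*} [NontriviallyNormedField K] [instK : NormedAlgebra ℚ_[p] K] [IsUltrametricDist K]
  [ProperSpace K]
variable {ϖ : Kˣ} (hϖ : IsUniformizer ϖ) {A : ℕ} (hA : absRamificationIdx p K = A * (p - 1))
include hϖ hA

/-! ### §5. Packaging over `m = torsionPExp p K` -/

omit hϖ hA in
/-- **A primitive `p^n`-th root of unity in `K` forces `n ≤ m = torsionPExp p K`** (its order `p^n` divides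
`#R^μ = p^m·(p^f − 1)`). [cite: NeukirchANT1999, Ch. II Prop. (5.7)] -/
theorem le_torsionPExp_of_isPrimitiveRoot {ξ : K} {n : ℕ} (hξ : IsPrimitiveRoot ξ (p ^ n)) :
    n ≤ torsionPExp p K := by
  classical
  haveI := finite_torsionUnits p K
  have hN : 0 < p ^ n := pow_pos hp.out.pos n
  have hξ0 : ξ ≠ 0 := hξ.ne_zero hN.ne'
  set u : Kˣ := Units.mk0 ξ hξ0 with hu
  have huprim : IsPrimitiveRoot u (p ^ n) := by
    rw [← IsPrimitiveRoot.coe_units_iff, hu, Units.val_mk0]; exact hξ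
  have hord : orderOf u = p ^ n := huprim.eq_orderOf.symm
  have hmem : u ∈ torsionUnits K := by
    change IsOfFinOrder u
    exact isOfFinOrder_iff_pow_eq_one.mpr ⟨p ^ n, hN, huprim.pow_eq_one⟩
  have hdvd : p ^ n ∣ Nat.card (torsionUnits K) := by
    rw [← hord, ← Subgroup.orderOf_mk u hmem]
    exact orderOf_dvd_natCard _
  have hcard0 : Nat.card (torsionUnits K) ≠ 0 := Nat.card_pos.ne'
  rw [torsionPExp]
  exact (padicValNat_dvd_iff_le hcard0).1 hdvd

omit hϖ hA in
/-- **A primitive `p^m`-th root of unity, `m = torsionPExp p K ≥ 1`, is NOT a `p`-th power in `K`** (a `p`-th root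
would be a primitive `p^{m+1}`-th root of unity). [cite: NeukirchANT1999, Ch. II Prop. (5.7)] -/
theorem not_pow_prime_eq_of_isPrimitiveRoot_torsionPExp (hm : 1 ≤ torsionPExp p K) {ξ : K}
    (hξ : IsPrimitiveRoot ξ (p ^ torsionPExp p K)) (η : K) : η ^ p ≠ ξ := by
  intro hη
  set m := torsionPExp p K with hm_def
  obtain ⟨m', hm'⟩ := Nat.exists_eq_add_one_of_ne_zero (by omega : m ≠ 0)
  -- `η` is a primitive `p^{m+1}`-th root of unity
  have hfin : η ^ p ^ (m + 1) = 1 := by rw [pow_succ', pow_mul, hη, hξ.pow_eq_one]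
  have hnot : ¬ η ^ p ^ m = 1 := by
    have hlt : p ^ m' < p ^ m := by rw [hm']; exact Nat.pow_lt_pow_right hp.out.one_lt (Nat.lt_succ_self m')
    rw [hm', pow_succ', pow_mul, hη]
    exact hξ.pow_ne_one_of_pos_of_lt (pow_pos hp.out.pos m').ne' hlt
  have hord : orderOf η = p ^ (m + 1) := orderOf_eq_prime_pow hnot hfin
  have hprim : IsPrimitiveRoot η (p ^ (m + 1)) := by rw [← hord]; exact IsPrimitiveRoot.orderOf η
  have hle := le_torsionPExp_of_isPrimitiveRoot p hprim
  rw [← hm_def] at hle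
  omega

/-- **THE CRITICAL BALL OVER `torsionPExp`** (`p` odd, `e = A(p−1)`, `m = torsionPExp p K ≥ 1`, `ξ` any primitive
`p^m`-th root of unity — one exists by abc-iut-w5-d039's `exists_isPrimitiveRoot_pow_torsionPExp`):
**`{‖z‖ ≤ ‖ϖ‖^A} ⊆ log_p(𝒪_K^×) ⟺ ∃ u ∈ K, ‖u^p − ξ‖ ≤ ‖p‖·‖ϖ‖^A`.** [cite: SerreLocalFields1979, Ch. XIV §4]
[cite: NeukirchANT1999, Ch. II Prop. (5.5)–(5.7)] -/
theorem closedBall_level_subset_logUnits_iff_torsionPExp (hp2 : p ≠ 2) (hm : 1 ≤ torsionPExp p K) {ξ : K}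
    (hξ : IsPrimitiveRoot ξ (p ^ torsionPExp p K)) :
    closedBall (0 : K) (‖(ϖ : K)‖ ^ A) ⊆ logUnits K ↔ ∃ u : K, ‖u ^ p - ξ‖ ≤ ‖(p : K)‖ * ‖(ϖ : K)‖ ^ A :=
  closedBall_level_subset_logUnits_iff_generator p hϖ hA hp2 hξ.pow_eq_one
    (not_pow_prime_eq_of_isPrimitiveRoot_torsionPExp p hm hξ)

/-- **`p^m ∤ A ⇒ r_in = A + 1`**, `m = torsionPExp p K ≥ 1`, i.e. `ζ_p ∈ K` (`p` odd, `e = A(p−1)`), in the R-W format: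
`closedBall 0 ‖ϖ‖^{A+1} ⊆ log_p(𝒪_K^×) ∧ ¬ closedBall 0 ‖ϖ‖^A ⊆ log_p(𝒪_K^×)` — e.g. `ζ_9 ∈ K_w` over `p = 3` with
`9 ∤ e_w/2`, or any `K ⊇ ℚ_p(ζ_{p²})` with `p² ∤ e/(p−1)`.  Decided by the two integers `(e, m)`; no search.
[cite: SerreLocalFields1979, Ch. XIV §4] [cite: NeukirchANT1999, Ch. II Prop. (5.5)–(5.7)] -/
theorem innerRadius_tie_succ_of_not_pow_torsionPExp_dvd (hp2 : p ≠ 2) (hm : 1 ≤ torsionPExp p K)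
    (hdvd : ¬ p ^ torsionPExp p K ∣ A) :
    closedBall (0 : K) (‖(ϖ : K)‖ ^ (A + 1)) ⊆ logUnits K ∧
      ¬ closedBall (0 : K) (‖(ϖ : K)‖ ^ A) ⊆ logUnits K := by
  obtain ⟨ξ, hξ⟩ := exists_isPrimitiveRoot_pow_torsionPExp p K
  obtain ⟨m', hm'⟩ := Nat.exists_eq_add_one_of_ne_zero (by omega : torsionPExp p K ≠ 0)
  have hξ' : IsPrimitiveRoot ξ (p ^ (m' + 1)) := by rw [← hm']; exact hξ
  exact innerRadius_tie_succ_of_not_pow_succ_dvd p hϖ hA hp2 hξ' (by rw [← hm']; exact hdvd)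

/-- **A torsion witness forces `p^m ∣ A`, `m = torsionPExp p K`** (abc-iut-s2-p12's open item (γ) in sharp form;
for `m = 1` this is `p ∣ A`). [cite: SerreLocalFields1979, Ch. XIV §4] [cite: NeukirchANT1999, Ch. II (5.5), (7.13)] -/
theorem pow_torsionPExp_dvd_level_of_torsionWitness {ζ' u : K} {n : ℕ} (hn : 0 < n) (hζ' : ζ' ^ n = 1)
    (hnot : ∀ η : K, η ^ p ≠ ζ') (hu : ‖u ^ p - ζ'‖ ≤ ‖(p : K)‖ * ‖(ϖ : K)‖ ^ A) :
    p ^ torsionPExp p K ∣ A := by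
  rcases Nat.eq_zero_or_pos (torsionPExp p K) with h0 | hm
  · rw [h0, pow_zero]; exact one_dvd A
  obtain ⟨ξ, hξ⟩ := exists_isPrimitiveRoot_pow_torsionPExp p K
  obtain ⟨m', hm'⟩ := Nat.exists_eq_add_one_of_ne_zero (by omega : torsionPExp p K ≠ 0)
  have hξ' : IsPrimitiveRoot ξ (p ^ (m' + 1)) := by rw [← hm']; exact hξ
  rw [hm']
  exact pow_succ_dvd_level_of_torsionWitness p hϖ hA hξ' hn hζ' hnot hu


/-! ### §6. A NEGATIVE CERTIFICATE: `ξ = u^p·v` with `v` of level `s < A·p`, `p ∤ s` -/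

/-- **Negative certificate for the torsion witness.**  If a `p`-power root of unity `ξ ∈ K` factors as
`ξ = u^p·v` with `‖1 − v‖ = ‖ϖ‖^s`, `1 ≤ s < A·p`, `p ∤ s`, then `K` has NO torsion witness: a witness would transfer
to `ξ` (§3 of the Generator file), `u₁^p = ξ·w₁` with `w₁ ∈ U^{(Ap)}`, and `(u₁/u)^p = v·w₁` would be the `p`-th power
of a principal unit with EXACT level `s` — but such levels are multiples of `p` (below the critical level,
abc-iut-s2-p12's `norm_one_add_pow_prime_sub_one_eq`) or `≥ A·p` (`norm_one_add_pow_prime_sub_one_le_prime_mul`).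
This is the certificate a greedy `p`-th-root lift of `ζ_{p^m}` produces when it gets stuck; checking it is one
norm computation. [cite: SerreLocalFields1979, Ch. XIV §4] [cite: NeukirchANT1999, Ch. II Prop. (5.5)] -/
theorem not_exists_torsionWitness_of_eq_pow_mul {ξ u v : K} {j : ℕ} (hξ : ξ ^ p ^ j = 1)
    (hξeq : ξ = u ^ p * v) {s : ℕ} (hs1 : 1 ≤ s) (hsA : s < A * p) (hps : ¬ p ∣ s)
    (hv : ‖1 - v‖ = ‖(ϖ : K)‖ ^ s) :
    ¬ ∃ ζ' u' : K, (∃ n : ℕ, 0 < n ∧ ζ' ^ n = 1) ∧ (∀ η : K, η ^ p ≠ ζ') ∧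
        ‖u' ^ p - ζ'‖ ≤ ‖(p : K)‖ * ‖(ϖ : K)‖ ^ A := by
  rintro ⟨ζ', u', ⟨n, hn, hζ'⟩, hnot, hu'⟩
  have hρ0 : 0 < ‖(ϖ : K)‖ := norm_units_pos ϖ
  have hr1 := norm_prime_mul_pow_level_lt_one p hϖ hA
  obtain ⟨u₁, hu₁⟩ := exists_norm_pow_sub_generator_le_of_torsionWitness p hϖ hA hξ hn hζ' hnot hu'
  -- norms
  have hξ1 : ‖ξ‖ = 1 := by
    have hj0 : p ^ j ≠ 0 := pow_ne_zero _ hp.out.ne_zero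
    have h := congrArg norm hξ
    rw [norm_pow, norm_one] at h
    exact (pow_eq_one_iff_of_nonneg (norm_nonneg _) hj0).mp h
  have hξ0 : ξ ≠ 0 := norm_pos_iff.mp (by rw [hξ1]; exact one_pos)
  have hvP : IsPrincipal v := by
    show ‖1 - v‖ < 1
    rw [hv]; exact pow_lt_one₀ hρ0.le hϖ.1 (by omega)
  have hv1 : ‖v‖ = 1 := hvP.norm_eq_one
  have hv0 : v ≠ 0 := norm_pos_iff.mp (by rw [hv1]; exact one_pos)
  have hup1 : ‖u ^ p‖ = 1 := by
    have h := congrArg norm hξeq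
    rw [hξ1, norm_mul, hv1, mul_one] at h
    exact h.symm
  have hup0 : u ^ p ≠ 0 := norm_pos_iff.mp (by rw [hup1]; exact one_pos)
  have hu₁p1 : ‖u₁ ^ p‖ = 1 := by
    have hd : ‖u₁ ^ p - ξ‖ < ‖ξ‖ := by rw [hξ1]; exact hu₁.trans_lt hr1
    have h : u₁ ^ p = ξ + (u₁ ^ p - ξ) := by ring
    rw [h, norm_add_eq_max_of_norm_ne_norm (ne_of_gt hd), max_eq_left hd.le, hξ1]
  -- `w₁ := u₁^p/ξ ∈ U^{(Ap)}` and `ω := u₁^p/u^p` with `ω = v·w₁`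
  set w₁ : K := u₁ ^ p * ξ⁻¹ with hw₁_def
  have hw₁ : ‖1 - w₁‖ ≤ ‖(p : K)‖ * ‖(ϖ : K)‖ ^ A := by
    have h : (1 : K) - w₁ = -((u₁ ^ p - ξ) * ξ⁻¹) := by
      rw [hw₁_def, sub_mul, mul_inv_cancel₀ hξ0]; ring
    rw [h, norm_neg, norm_mul, norm_inv, hξ1, inv_one, mul_one]; exact hu₁
  have hωp : (u₁ * u⁻¹) ^ p = v * w₁ := by
    rw [mul_pow, inv_pow, hw₁_def, hξeq, mul_inv, ← mul_assoc, mul_comm v (u₁ ^ p), mul_assoc (u₁ ^ p) v,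
      mul_comm v ((u ^ p)⁻¹ * v⁻¹), mul_assoc, inv_mul_cancel₀ hv0, mul_one]
  -- the level of `(u₁/u)^p` is EXACTLY `s`
  have hlt : ‖(p : K)‖ * ‖(ϖ : K)‖ ^ A < ‖(ϖ : K)‖ ^ s := by
    rw [norm_prime_mul_pow_level p hϖ hA]
    exact pow_lt_pow_right_of_lt_one₀ hρ0 hϖ.1 hsA
  have hωs : ‖1 - (u₁ * u⁻¹) ^ p‖ = ‖(ϖ : K)‖ ^ s := by
    rw [hωp]
    have hsmall : ‖v * (1 - w₁)‖ < ‖1 - v‖ := by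
      rw [norm_mul, hv1, one_mul, hv]; exact hw₁.trans_lt hlt
    have h : (1 : K) - v * w₁ = (1 - v) + v * (1 - w₁) := by ring
    rw [h, norm_add_eq_max_of_norm_ne_norm (ne_of_gt hsmall), max_eq_left hsmall.le, hv]
  have hωpP : IsPrincipal ((u₁ * u⁻¹) ^ p) := by
    show ‖1 - (u₁ * u⁻¹) ^ p‖ < 1
    rw [hωs]; exact pow_lt_one₀ hρ0.le hϖ.1 (by omega)
  have hω1 : ‖u₁ * u⁻¹‖ = 1 := norm_eq_one_of_isPrincipal_pow hp.out.pos hωpP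
  have hωP : IsPrincipal (u₁ * u⁻¹) := IsPrincipal.of_pow_prime (p := p) hω1.le hωpP
  by_cases hlev : ‖(ϖ : K)‖ ^ A < ‖1 - u₁ * u⁻¹‖
  · -- below the critical level the `p`-th power is exact: `s = p·t`
    have h := norm_one_add_pow_prime_sub_one_eq p hϖ hA (x := u₁ * u⁻¹ - 1) (by rwa [norm_sub_rev])
      (by rw [norm_sub_rev]; exact hωP.le)
    rw [add_sub_cancel, norm_sub_rev, hωs, norm_sub_rev] at h
    have hy : (1 : K) - u₁ * u⁻¹ ≠ 0 := norm_pos_iff.mp ((pow_pos hρ0 _).trans hlev)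
    obtain ⟨t, ht⟩ := hϖ.2 (Units.mk0 (1 - u₁ * u⁻¹) hy)
    rw [Units.val_mk0] at ht
    have h2 : ‖(ϖ : K)‖ ^ (s : ℤ) = ‖(ϖ : K)‖ ^ (t * (p : ℤ)) := by
      rw [zpow_natCast, h, ht, ← zpow_natCast, ← zpow_mul]
    have hst : (s : ℤ) = t * (p : ℤ) := zpow_right_injective₀ hρ0 hϖ.1.ne h2
    exact hps (Int.natCast_dvd_natCast.mp ⟨t, by rw [hst, mul_comm]⟩)
  · -- level `≥ A` would put the `p`-th power inside `U^{(Ap)}`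
    push Not at hlev
    have h := norm_one_add_pow_prime_sub_one_le_prime_mul p hϖ hA (x := u₁ * u⁻¹ - 1) (by rwa [norm_sub_rev])
    rw [add_sub_cancel, norm_sub_rev, hωs] at h
    exact absurd h (not_le.mpr hlt)

/-- **Negative certificate ⇒ `r_in = A + 1`** (R-W format; `p` odd, `e = A(p−1)`): if a `p`-power root of unity
`ξ ≠ 1` of `K` (so `ζ_p ∈ K`) factors as `ξ = u^p·v` with `‖1 − v‖ = ‖ϖ‖^s`, `1 ≤ s < A·p`, `p ∤ s`, then
`closedBall 0 ‖ϖ‖^{A+1} ⊆ log_p(𝒪_K^×)` and `¬ closedBall 0 ‖ϖ‖^A ⊆ log_p(𝒪_K^×)`.  With §5 this is the complete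
decision kit for col «rho_in» at `ζ_p`-places with `p^m ∣ A`: exhibit `u` with `‖u^p − ζ_{p^m}‖ ≤ ‖p‖·‖ϖ‖^A`
(`r_in ≤ A`) or `(u, v, s)` as here (`r_in = A + 1`). [cite: SerreLocalFields1979, Ch. XIV §4]
[cite: NeukirchANT1999, Ch. II Prop. (5.5)–(5.7)] -/
theorem innerRadius_tie_succ_of_eq_pow_mul (hp2 : p ≠ 2) {ξ u v : K} {j : ℕ} (hξ : ξ ^ p ^ j = 1) (hξ1 : ξ ≠ 1)
    (hξeq : ξ = u ^ p * v) {s : ℕ} (hs1 : 1 ≤ s) (hsA : s < A * p) (hps : ¬ p ∣ s)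
    (hv : ‖1 - v‖ = ‖(ϖ : K)‖ ^ s) :
    closedBall (0 : K) (‖(ϖ : K)‖ ^ (A + 1)) ⊆ logUnits K ∧
      ¬ closedBall (0 : K) (‖(ϖ : K)‖ ^ A) ⊆ logUnits K := by
  obtain ⟨ζ, hζ, hζ1⟩ := exists_pow_prime_eq_one_ne_one_of_ppow p hξ hξ1
  have hno := not_exists_torsionWitness_of_eq_pow_mul p hϖ hA hξ hξeq hs1 hsA hps hv
  refine innerRadius_tie_succ_of_forall_not_torsionWitness p hϖ hA hp2 hζ hζ1 fun ζ' u' hT hnot => ?_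
  by_contra hle
  push Not at hle
  exact hno ⟨ζ', u', hT, hnot, hle⟩

end Field

end LogEnvelope

end Literature.IUT.LogVolume

end
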